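import Summits.CriticalPhenomena.CardyFormulaZ2.Theorems.CardyBoundaryCoulombGasStripClusterRatesKacOneOfCardyOrderOne
import Summits.CriticalPhenomena.CardyFormulaZ2.Theorems.CardyBoundaryCoulombGasStripClusterRatesCardyOrderOneOfKacOne
import Summits.CriticalPhenomena.CardyFormulaZ2.Theorems.CardyBoundaryCoulombGasStripClusterRatesCardyOrderOneOfRectCardyOne
import Summits.CriticalPhenomena.CardyFormulaZ2.Theorems.CardyBoundaryCoulombGasStripClusterRatesCardyOrderTwoLowerOfKacTwo
import Summits.CriticalPhenomena.CardyFormulaZ2.Theorems.CardyBoundaryCoulombGasStripClusterRatesConfinedGlueTransfer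
import Summits.CriticalPhenomena.CardyFormulaZ2.Theorems.CardyBoundaryCoulombGasStripClusterRatesStubLamRLog
import Summits.CriticalPhenomena.CardyFormulaZ2.Theorems.CardyBoundaryCoulombGasStripClusterRatesStubCardyLog

/-!
# `StripClusterRates` in Cardy order: the γ₁-half IS the Cardy-order one-cluster Kac statement CO₁,
# and the crux is `CO₁ ∧ K₂`, implied by `CO₁ ∧ CO₂`

Support file for line `two-cluster-rate-is-stationary-gap` (crux `StripClusterRates`,
stmt-CriticalPhenomena-13878), lead c7, RESHAPE 6. The crux takes its limits in TRANSFER-MATRIX ORDER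
(`m → ∞` at fixed width `n`, then `n → ∞`); Cardy's prediction (1998, eq. (bb)) is printed in CARDY ORDER
(mesh → 0 at fixed aspect ratio `A`, then `A → ∞`). For ONE spanning cluster the two orders are
interchangeable UNCONDITIONALLY, because `p₁(m,n) = P_{1/2}[LR crossing of [0,m]×[0,n]]` is sub-multiplicative
in the length (independence of disjoint blocks, `Negative.rateOne_ge_finite`) and super-multiplicative up to the
absolute constant `1/2` (Harris–FKG gluing through a top–bottom crossing of a square, `stub_sandwichUpper`):

* CO₁ (Cardy-order one-cluster Kac, two-sided): `∃ g G, g(A)/A → π/3, G(A)/A → π/3, ∀ A ≥ 1, eventually in n,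
  e^{−G(A)} ≤ p₁(A·n, n) ≤ e^{−g(A)}`;
* K₁ (the γ₁-half of the crux, transfer-matrix order): `n·γ₁(n) → π/3` for every family of one-cluster rates.

§1 `oneClusterKac_iff_cardyOrderOne : K₁ ↔ CO₁` (wave 1 of c7: `co_kacOne_of_cardyOrderOne` p139491,
`co_cardyOrderOne_of_kacOne` p139481; existence of rates from the landed `oneClusterRate_eq_escapeRate`).
§2 CO₁ from Cardy's formula: `cardyOrderOne_of_rectCardyOne` (`co_cardyOrderOne_of_rectCardyOne` p139518 fed
with the landed `stub_lamRLog`, `stub_cardyLog`), hence from `CardyRectangle` (stmt-4782), from crux 4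
`RectilinearCardy` (stmt-5660) and from the conjunct `CardyFormulaZ2`.
§3 The crux against CO₁: `stripClusterRates_of_oneClusterKac_of_kacTwo` (K₁ ∧ K₂ ⇒ crux, rates chosen from the
landed dictionary/spectral theorems), `stripClusterRates_of_cardyOrderOne_of_kacTwo`,
`stripClusterRates_of_cardyOrderOne_of_cardyOrderTwo` (THE RESHAPE-6 COMPOSITION: crux ⟸ CO₁ ∧ CO₂, two
statements of identical shape — the Cardy-order strip Kac exponents `h_{1,3} = 1/3` and `h_{1,5} = 2`),
`oneClusterKac_of_stripClusterRates`, `cardyOrderOne_of_stripClusterRates` (CO₁ is NECESSARY),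
`stripClusterRates_iff_cardyOrderOne_and_kacTwo : crux ↔ CO₁ ∧ K₂` (both conjuncts necessary and jointly
sufficient, unconditionally), and `cardyOrderTwoLower_of_stripClusterRates` (the plain Cardy-order LOWER bound
of CO₂ is necessary too, `co_cardyOrderTwoLower_of_kacTwo` p139360; the plain UPPER bound would need two-cluster
quasi-multiplicativity and the confined lower bound is CO₂'s genuine extra content).

No definitions; every statement is expanded over `crossingProb`, the two-cluster event and `planarTransfer`.

References: [Cardy1998] eq. (bb); [CardyJPhysA1992]; M. Fekete (1923); [Aizenman1997] Thm 3.
-/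

noncomputable section

open MeasureTheory Filter Topology Set
open Literature.Probability.LatticeModels Literature.Probability.Percolation

namespace Summit.CriticalPhenomena.CardyFormulaZ2.Cruxes.StripClusterRates.TwoClusterRateIsStationaryGap

/-! ## §1 Transfer-matrix order ⟺ Cardy order for one spanning cluster -/

/-- **K₁ ⟺ CO₁.** For bond percolation on `ℤ²` at `p = 1/2`: `n·γ₁(n) → π/3` for every family of one-cluster
lengthwise rates `γ₁(n) = lim_m −log p₁(m,n)/m` (transfer-matrix order) if and only if there are `g, G` with
`g(A)/A → π/3`, `G(A)/A → π/3` and, for every integer aspect `A ≥ 1`, eventually in the width `n`,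
`e^{−G(A)} ≤ p₁(A·n, n) ≤ e^{−g(A)}` (Cardy order). The Fekete sandwich both ways; rates exist by
`oneClusterRate_eq_escapeRate`. [cite: Cardy1998, eq. (bb)] -/
theorem oneClusterKac_iff_cardyOrderOne :
    (∀ γ : ℕ → ℝ, (∀ n : ℕ, 1 ≤ n → Tendsto (fun m : ℕ ↦ -Real.log (crossingProb half m n) / (m : ℝ)) atTop (𝓝 (γ n))) → Tendsto (fun n : ℕ ↦ (n : ℝ) * γ n) atTop (𝓝 (Real.pi / 3))) ↔ (∃ g G : ℕ → ℝ, Tendsto (fun A : ℕ ↦ g A / A) atTop (𝓝 (Real.pi / 3)) ∧ Tendsto (fun A : ℕ ↦ G A / A) atTop (𝓝 (Real.pi / 3)) ∧ ∀ A : ℕ, 1 ≤ A → ∀ᶠ n : ℕ in atTop, Real.exp (-G A) ≤ crossingProb half (A * n) n ∧ crossingProb half (A * n) n ≤ Real.exp (-g A)) := by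
  constructor
  · intro hK
    -- a family of one-cluster rates exists (junk value `0` at width `0`)
    have h₁ := oneClusterRate_eq_escapeRate
    let γ : ℕ → ℝ := fun n => if hn : 1 ≤ n then (h₁ n hn).choose else 0
    have hγ : ∀ n : ℕ, 1 ≤ n →
        Tendsto (fun m : ℕ ↦ -Real.log (crossingProb half m n) / (m : ℝ)) atTop (𝓝 (γ n)) := by
      intro n hn
      have : γ n = (h₁ n hn).choose := dif_pos hn
      rw [this]
      exact (h₁ n hn).choose_spec.1
    exact co_cardyOrderOne_of_kacOne γ hγ (hK γ hγ)
  · exact co_kacOne_of_cardyOrderOne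

/-! ## §2 CO₁ from Cardy's formula for lattice rectangles -/

/-- **RC₁ ⟹ CO₁**: Cardy's value for the lattice rectangles `(A·k−2) × (k−2)` (`→ F(λ(iA))` for every integer
aspect `A ≥ 1`) implies the two-sided Cardy-order Kac bounds for `p₁(A·n, n)` with `g(A)/A, G(A)/A → π/3`
(`co_cardyOrderOne_of_rectCardyOne` with the landed `log λ(it)/t → −π` and `log F(η)/log η → 1/3`).
[cite: CardyJPhysA1992, eq. (PI)] -/
theorem cardyOrderOne_of_rectCardyOne
    (hR : ∀ A : ℕ, 1 ≤ A → Tendsto (fun k : ℕ ↦ crossingProb half (A * k - 2) (k - 2)) atTop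
      (𝓝 (Literature.Probability.RandomPlanarGeometry.cardyFunction
        (Literature.Probability.RandomPlanarGeometry.KlebanZagier.lamR A)))) :
    ∃ g G : ℕ → ℝ, Tendsto (fun A : ℕ ↦ g A / A) atTop (𝓝 (Real.pi / 3)) ∧ Tendsto (fun A : ℕ ↦ G A / A) atTop (𝓝 (Real.pi / 3)) ∧ ∀ A : ℕ, 1 ≤ A → ∀ᶠ n : ℕ in atTop, Real.exp (-G A) ≤ crossingProb half (A * n) n ∧ crossingProb half (A * n) n ≤ Real.exp (-g A) :=
  co_cardyOrderOne_of_rectCardyOne stub_lamRLog stub_cardyLog hR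

/-- **`RectilinearCardy` ⟹ CO₁** (crux 4 of the route, stmt-CriticalPhenomena-5660; through the landed
`rc_rectCardyOne_of_parts`). [cite: CardyJPhysA1992, eq. (PI)] -/
theorem cardyOrderOne_of_rectilinearCardy
    (h₄ : Summit.CriticalPhenomena.CardyFormulaZ2.Theses.CardyBoundaryCoulombGas.RectilinearCardy) :
    ∃ g G : ℕ → ℝ, Tendsto (fun A : ℕ ↦ g A / A) atTop (𝓝 (Real.pi / 3)) ∧ Tendsto (fun A : ℕ ↦ G A / A) atTop (𝓝 (Real.pi / 3)) ∧ ∀ A : ℕ, 1 ≤ A → ∀ᶠ n : ℕ in atTop, Real.exp (-G A) ≤ crossingProb half (A * n) n ∧ crossingProb half (A * n) n ≤ Real.exp (-g A) :=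
  cardyOrderOne_of_rectCardyOne (rc_rectCardyOne_of_parts rc_exists_boxRect rc_box_dictionary h₄)

/-- **`CardyRectangle` ⟹ CO₁** (stmt-CriticalPhenomena-4782 of route `CardyPolygonWords`: Cardy for corner-marked
rectangles; through the landed `rc_rectCardyOne_of_cardyRectangle`). [cite: CardyJPhysA1992, eq. (PI)] -/
theorem cardyOrderOne_of_cardyRectangle
    (h : Summit.CriticalPhenomena.CardyFormulaZ2.Theses.CardyPolygonWords.CardyRectangle) :
    ∃ g G : ℕ → ℝ, Tendsto (fun A : ℕ ↦ g A / A) atTop (𝓝 (Real.pi / 3)) ∧ Tendsto (fun A : ℕ ↦ G A / A) atTop (𝓝 (Real.pi / 3)) ∧ ∀ A : ℕ, 1 ≤ A → ∀ᶠ n : ℕ in atTop, Real.exp (-G A) ≤ crossingProb half (A * n) n ∧ crossingProb half (A * n) n ≤ Real.exp (-g A) :=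
  cardyOrderOne_of_rectCardyOne (rc_rectCardyOne_of_cardyRectangle h)

/-- **The conjunct ⟹ CO₁**: Cardy's formula for bond-`ℤ²` in every conformal rectangle gives the Cardy-order
one-cluster Kac bounds. [cite: CardyJPhysA1992, eq. (PI)] -/
theorem cardyOrderOne_of_cardyFormulaZ2 (h : _root_.CardyFormulaZ2) :
    ∃ g G : ℕ → ℝ, Tendsto (fun A : ℕ ↦ g A / A) atTop (𝓝 (Real.pi / 3)) ∧ Tendsto (fun A : ℕ ↦ G A / A) atTop (𝓝 (Real.pi / 3)) ∧ ∀ A : ℕ, 1 ≤ A → ∀ᶠ n : ℕ in atTop, Real.exp (-G A) ≤ crossingProb half (A * n) n ∧ crossingProb half (A * n) n ≤ Real.exp (-g A) :=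
  cardyOrderOne_of_rectilinearCardy (rectilinearCardy_of_cardyFormulaZ2 h)

/-! ## §3 The crux against CO₁ -/

/-- **K₁ ∧ K₂ ⟹ `StripClusterRates`.** If every family of one-cluster rates has `n·γ₁(n) → π/3` and every family
of relaxation moduli of the stationary connectivity chains `planarTransfer (Finset.Icc 0 n)` has
`n·(−log s(n)) → 2π`, the crux holds: the rates are chosen from the landed dictionary/spectral theorems
`oneClusterRate_eq_escapeRate`, `twoClusterRate_eq_relaxationRate` (junk `0` at width `0`).
[cite: Cardy1998, eq. (bb)] -/
theorem stripClusterRates_of_oneClusterKac_of_kacTwo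
    (hK₁ : ∀ γ : ℕ → ℝ, (∀ n : ℕ, 1 ≤ n → Tendsto (fun m : ℕ ↦ -Real.log (crossingProb half m n) / (m : ℝ)) atTop (𝓝 (γ n))) → Tendsto (fun n : ℕ ↦ (n : ℝ) * γ n) atTop (𝓝 (Real.pi / 3)))
    (hK₂ : ∀ s : ℕ → ℝ,
      (∀ n : ℕ, 1 ≤ n →
        ((∃ (μ : ℂ) (v : PlanarRowState (Finset.Icc (0 : ℤ) n) → ℂ),
          (v ≠ 0 ∧ (∀ p, (∃ x, p.1.JoinedToStar x) → v p = 0) ∧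
            ∀ p, (∀ x, ¬ p.1.JoinedToStar x) →
              ∑ q, (planarTransfer (Finset.Icc (0 : ℤ) n) p q : ℂ) * v q = μ * v p) ∧
          μ ≠ 1 ∧ ‖μ‖ = s n) ∧
        ∀ (μ : ℂ) (v : PlanarRowState (Finset.Icc (0 : ℤ) n) → ℂ),
          (v ≠ 0 ∧ (∀ p, (∃ x, p.1.JoinedToStar x) → v p = 0) ∧
            ∀ p, (∀ x, ¬ p.1.JoinedToStar x) →
              ∑ q, (planarTransfer (Finset.Icc (0 : ℤ) n) p q : ℂ) * v q = μ * v p) →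
          μ ≠ 1 → ‖μ‖ ≤ s n)) →
      Tendsto (fun n : ℕ ↦ (n : ℝ) * -Real.log (s n)) atTop (𝓝 (2 * Real.pi))) :
    Summit.CriticalPhenomena.CardyFormulaZ2.Theses.CardyBoundaryCoulombGas.StripClusterRates := by
  have h₁ := oneClusterRate_eq_escapeRate
  have h₂ := twoClusterRate_eq_relaxationRate
  let γ₁ : ℕ → ℝ := fun n => if hn : 1 ≤ n then (h₁ n hn).choose else 0
  let γ₂ : ℕ → ℝ := fun n => if hn : 1 ≤ n then (h₂ n hn).choose else 0
  have hγ₁ : ∀ n : ℕ, ∀ hn : 1 ≤ n, γ₁ n = (h₁ n hn).choose := fun n hn => dif_pos hn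
  have hγ₂ : ∀ n : ℕ, ∀ hn : 1 ≤ n, γ₂ n = (h₂ n hn).choose := fun n hn => dif_pos hn
  have hrate₁ : ∀ n : ℕ, 1 ≤ n →
      Tendsto (fun m : ℕ ↦ -Real.log (crossingProb half m n) / (m : ℝ)) atTop (𝓝 (γ₁ n)) := by
    intro n hn
    rw [hγ₁ n hn]
    exact (h₁ n hn).choose_spec.1
  refine ⟨γ₁, γ₂, hrate₁, ?_, hK₁ γ₁ hrate₁, ?_⟩
  · intro n hn
    rw [hγ₂ n hn]
    exact (h₂ n hn).choose_spec.1
  · have h := hK₂ (fun n => Real.exp (-γ₂ n)) (fun n hn => by rw [hγ₂ n hn]; exact (h₂ n hn).choose_spec.2)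
    refine h.congr' (Eventually.of_forall fun n => ?_)
    exact red_mul_neg_log_exp_neg n (γ₂ n)

/-- **CO₁ ∧ K₂ ⟹ `StripClusterRates`** (`co_kacOne_of_cardyOrderOne` turns CO₁ into K₁). [cite: Cardy1998, eq. (bb)] -/
theorem stripClusterRates_of_cardyOrderOne_of_kacTwo
    (hCO₁ : ∃ g G : ℕ → ℝ, Tendsto (fun A : ℕ ↦ g A / A) atTop (𝓝 (Real.pi / 3)) ∧ Tendsto (fun A : ℕ ↦ G A / A) atTop (𝓝 (Real.pi / 3)) ∧ ∀ A : ℕ, 1 ≤ A → ∀ᶠ n : ℕ in atTop, Real.exp (-G A) ≤ crossingProb half (A * n) n ∧ crossingProb half (A * n) n ≤ Real.exp (-g A))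
    (hK₂ : ∀ s : ℕ → ℝ,
      (∀ n : ℕ, 1 ≤ n →
        ((∃ (μ : ℂ) (v : PlanarRowState (Finset.Icc (0 : ℤ) n) → ℂ),
          (v ≠ 0 ∧ (∀ p, (∃ x, p.1.JoinedToStar x) → v p = 0) ∧
            ∀ p, (∀ x, ¬ p.1.JoinedToStar x) →
              ∑ q, (planarTransfer (Finset.Icc (0 : ℤ) n) p q : ℂ) * v q = μ * v p) ∧
          μ ≠ 1 ∧ ‖μ‖ = s n) ∧
        ∀ (μ : ℂ) (v : PlanarRowState (Finset.Icc (0 : ℤ) n) → ℂ),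
          (v ≠ 0 ∧ (∀ p, (∃ x, p.1.JoinedToStar x) → v p = 0) ∧
            ∀ p, (∀ x, ¬ p.1.JoinedToStar x) →
              ∑ q, (planarTransfer (Finset.Icc (0 : ℤ) n) p q : ℂ) * v q = μ * v p) →
          μ ≠ 1 → ‖μ‖ ≤ s n)) →
      Tendsto (fun n : ℕ ↦ (n : ℝ) * -Real.log (s n)) atTop (𝓝 (2 * Real.pi))) :
    Summit.CriticalPhenomena.CardyFormulaZ2.Theses.CardyBoundaryCoulombGas.StripClusterRates :=
  stripClusterRates_of_oneClusterKac_of_kacTwo (co_kacOne_of_cardyOrderOne hCO₁) hK₂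

/-- **RESHAPE-6 COMPOSITION: CO₁ ∧ CO₂ ⟹ `StripClusterRates`.** The crux of route `CardyBoundaryCoulombGas` from
the two CARDY-ORDER strip Kac statements of identical shape — CO₁ (one spanning cluster, `h_{1,3} = 1/3`:
two-sided eventual bounds `e^{−G(A)} ≤ p₁(A·n,n) ≤ e^{−g(A)}`, `g(A)/A, G(A)/A → π/3`) and CO₂ (two distinct
spanning clusters, `h_{1,5} = 2`: plain event from above, end-confined event from below, rates `/A → 2π`) —
everything else (dictionaries, Perron/relaxation identification, Fekete sandwiches, confined gluing, order
transfers) being kernel-checked lattice work of leads −1…c7 (`kacTwo_of_cardyOrderTwo`, p131473).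
[cite: Cardy1998, eq. (bb)] -/
theorem stripClusterRates_of_cardyOrderOne_of_cardyOrderTwo
    (hCO₁ : ∃ g G : ℕ → ℝ, Tendsto (fun A : ℕ ↦ g A / A) atTop (𝓝 (Real.pi / 3)) ∧ Tendsto (fun A : ℕ ↦ G A / A) atTop (𝓝 (Real.pi / 3)) ∧ ∀ A : ℕ, 1 ≤ A → ∀ᶠ n : ℕ in atTop, Real.exp (-G A) ≤ crossingProb half (A * n) n ∧ crossingProb half (A * n) n ≤ Real.exp (-g A))
    (hCO₂ : (∃ g : ℕ → ℝ, Tendsto (fun A : ℕ ↦ g A / A) atTop (𝓝 (2 * Real.pi)) ∧ ∀ A : ℕ, 1 ≤ A → ∀ᶠ n : ℕ in atTop, (bondPercolation (zdGraph 2) half).real {ω | ∃ x₁ ∈ (leftSide (A * n) n : Set (Site 2)), ∃ y₁ ∈ (rightSide (A * n) n : Set (Site 2)), ∃ x₂ ∈ (leftSide (A * n) n : Set (Site 2)), ∃ y₂ ∈ (rightSide (A * n) n : Set (Site 2)), ω ∈ openConnIn (rectangle (A * n) n : Set (Site 2)) x₁ y₁ ∧ ω ∈ openConnIn (rectangle (A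 * n) n : Set (Site 2)) x₂ y₂ ∧ ω ∉ openConnIn (rectangle (A * n) n : Set (Site 2)) x₁ x₂} ≤ Real.exp (-g A)) ∧ (∃ G : ℕ → ℝ, Tendsto (fun A : ℕ ↦ G A / A) atTop (𝓝 (2 * Real.pi)) ∧ ∀ A : ℕ, 1 ≤ A → ∀ᶠ b : ℕ in atTop, Real.exp (-G A) ≤ (bondPercolation (zdGraph 2) half).real ((openCrossing {z ∈ (rectangle (A * (3 * b + 2) : ℕ) (3 * b + 2) : Set (Site 2)) | (z 0 ≤ (b : ℤ) ∨ ((A * (3 * b + 2) : ℕ) : ℤ) ≤ z 0 + b) → z 1 ≤ (b : ℤ)} (leftSide (A * (3 * b + 2) : ℕ) (3 * b + 2) : Set (Site 2)) (rightSide (A * (3 * b + 2) : ℕ) (3 * b + 2) : Set (Site 2)) ∩ tbCrossing b b ∩ openCrossing {z ∈ (rectangle (A * (3 * b + 2) : ℕ) (3 * b + 2) : Set (Site 2)) | (z 0 ≤ (b : ℤ) ∨ ((A * (3 * b + 2) : ℕ) : ℤ) ≤ z 0 + b) → 2 * (b : ℤ) + 2 ≤ z 1} (leftSide (A * (3 *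 b + 2) : ℕ) (3 * b + 2) : Set (Site 2)) (rightSide (A * (3 * b + 2) : ℕ) (3 * b + 2) : Set (Site 2)) ∩ (BondConfig.relabel (sym2Equiv (Site.shift (-pt 0 (2 * (b : ℤ) + 2))))) ⁻¹' tbCrossing b b) ∩ (dualConfig ⁻¹' openCrossing {z ∈ ((· + pt (-1) 0) '' (rectangle ((A * (3 * b + 2) : ℕ) + 1) (3 * b + 1) : Set (Site 2))) | (z 0 ≤ (b : ℤ) ∨ ((A * (3 * b + 2) : ℕ) : ℤ) ≤ z 0 + b) → (b : ℤ) + 1 ≤ z 1 ∧ z 1 ≤ 2 * (b : ℤ)} ((· + pt (-1) 0) '' (leftSide ((A * (3 * b + 2) : ℕ) + 1) (3 * b + 1) : Set (Site 2))) ((· + pt (-1) 0) '' (rightSide ((A * (3 * b + 2) : ℕ) + 1) (3 * b + 1) : Set (Site 2))))))) :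
    Summit.CriticalPhenomena.CardyFormulaZ2.Theses.CardyBoundaryCoulombGas.StripClusterRates :=
  stripClusterRates_of_cardyOrderOne_of_kacTwo hCO₁ (kacTwo_of_cardyOrderTwo hCO₂)

/-- **The crux implies K₁**: from `StripClusterRates`, EVERY family of one-cluster rates has `n·γ₁(n) → π/3`
(the crux provides one family with the limit; any other agrees with it at every width `n ≥ 1`, limits being
unique). [cite: Cardy1998, eq. (bb)] -/
theorem oneClusterKac_of_stripClusterRates
    (h : Summit.CriticalPhenomena.CardyFormulaZ2.Theses.CardyBoundaryCoulombGas.StripClusterRates) :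
    ∀ γ : ℕ → ℝ, (∀ n : ℕ, 1 ≤ n → Tendsto (fun m : ℕ ↦ -Real.log (crossingProb half m n) / (m : ℝ)) atTop (𝓝 (γ n))) → Tendsto (fun n : ℕ ↦ (n : ℝ) * γ n) atTop (𝓝 (Real.pi / 3)) := by
  obtain ⟨γ₁, γ₂, h₁, -, h₃, -⟩ := h
  intro γ hγ
  refine h₃.congr' ?_
  filter_upwards [eventually_ge_atTop 1] with n hn
  rw [tendsto_nhds_unique (hγ n hn) (h₁ n hn)]

/-- **CO₁ is NECESSARY**: `StripClusterRates` implies the two-sided Cardy-order one-cluster Kac bounds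
(`co_cardyOrderOne_of_kacOne` on the crux's own rates). [cite: Cardy1998, eq. (bb)] -/
theorem cardyOrderOne_of_stripClusterRates
    (h : Summit.CriticalPhenomena.CardyFormulaZ2.Theses.CardyBoundaryCoulombGas.StripClusterRates) :
    ∃ g G : ℕ → ℝ, Tendsto (fun A : ℕ ↦ g A / A) atTop (𝓝 (Real.pi / 3)) ∧ Tendsto (fun A : ℕ ↦ G A / A) atTop (𝓝 (Real.pi / 3)) ∧ ∀ A : ℕ, 1 ≤ A → ∀ᶠ n : ℕ in atTop, Real.exp (-G A) ≤ crossingProb half (A * n) n ∧ crossingProb half (A * n) n ≤ Real.exp (-g A) := by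
  obtain ⟨γ₁, γ₂, h₁, -, h₃, -⟩ := h
  exact co_cardyOrderOne_of_kacOne γ₁ h₁ h₃

/-- **`StripClusterRates ⟺ CO₁ ∧ K₂`** (unconditionally): the crux of route `CardyBoundaryCoulombGas` holds if and
only if (CO₁) the Cardy-order one-cluster Kac bounds hold AND (K₂) the relaxation moduli of the stationary
connectivity chains `planarTransfer (Finset.Icc 0 n)` have the Kac asymptotics `n·(−log s(n)) → 2π`. Both
conjuncts are necessary (`cardyOrderOne_of_stripClusterRates`, `kacTwo_of_stripClusterRates`) and jointly
sufficient (`stripClusterRates_of_cardyOrderOne_of_kacTwo`). [cite: Cardy1998, eq. (bb)] -/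
theorem stripClusterRates_iff_cardyOrderOne_and_kacTwo :
    Summit.CriticalPhenomena.CardyFormulaZ2.Theses.CardyBoundaryCoulombGas.StripClusterRates ↔ ((∃ g G : ℕ → ℝ, Tendsto (fun A : ℕ ↦ g A / A) atTop (𝓝 (Real.pi / 3)) ∧ Tendsto (fun A : ℕ ↦ G A / A) atTop (𝓝 (Real.pi / 3)) ∧ ∀ A : ℕ, 1 ≤ A → ∀ᶠ n : ℕ in atTop, Real.exp (-G A) ≤ crossingProb half (A * n) n ∧ crossingProb half (A * n) n ≤ Real.exp (-g A)) ∧ (∀ s : ℕ → ℝ, (∀ n : ℕ, 1 ≤ n → ((∃ (μ : ℂ) (v : PlanarRowState (Finset.Icc (0 : ℤ) n) → ℂ), (v ≠ 0 ∧ (∀ p, (∃ x, p.1.JoinedToStar x) → v p = 0) ∧ ∀ p, (∀ x, ¬ p.1.JoinedToStar x) → ∑ q, (planarTransfer (Finset.Icc (0 : ℤ) n) p q : ℂ) * v q = μ * v p) ∧ μ ≠ 1 ∧ ‖μ‖ = s n) ∧ ∀ (μ : ℂ) (v : PlanarRowState (Finset.Icc (0 : ℤ) n) → ℂ), (v ≠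 0 ∧ (∀ p, (∃ x, p.1.JoinedToStar x) → v p = 0) ∧ ∀ p, (∀ x, ¬ p.1.JoinedToStar x) → ∑ q, (planarTransfer (Finset.Icc (0 : ℤ) n) p q : ℂ) * v q = μ * v p) → μ ≠ 1 → ‖μ‖ ≤ s n)) → Tendsto (fun n : ℕ ↦ (n : ℝ) * -Real.log (s n)) atTop (𝓝 (2 * Real.pi)))) :=
  ⟨fun h => ⟨cardyOrderOne_of_stripClusterRates h, kacTwo_of_stripClusterRates h⟩,
    fun h => stripClusterRates_of_cardyOrderOne_of_kacTwo h.1 h.2⟩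

/-- **The plain Cardy-order two-cluster LOWER bound is necessary**: `StripClusterRates` gives `G` with `G(A)/A → 2π`
and, for every `A ≥ 1`, eventually in `n`, `e^{−G(A)} ≤ p₂(A·n, n)` (`co_cardyOrderTwoLower_of_kacTwo` on the
crux's own two-cluster rates; sub-multiplicativity of `p₂`). The plain UPPER bound and the CONFINED lower
bound of CO₂ are the parts of CO₂ not known to be necessary. [cite: Cardy1998, eq. (bb)] -/
theorem cardyOrderTwoLower_of_stripClusterRates
    (h : Summit.CriticalPhenomena.CardyFormulaZ2.Theses.CardyBoundaryCoulombGas.StripClusterRates) :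
    ∃ G : ℕ → ℝ, Tendsto (fun A : ℕ ↦ G A / A) atTop (𝓝 (2 * Real.pi)) ∧ ∀ A : ℕ, 1 ≤ A → ∀ᶠ n : ℕ in atTop, Real.exp (-G A) ≤ (bondPercolation (zdGraph 2) half).real {ω | ∃ x₁ ∈ (leftSide (A * n) n : Set (Site 2)), ∃ y₁ ∈ (rightSide (A * n) n : Set (Site 2)), ∃ x₂ ∈ (leftSide (A * n) n : Set (Site 2)), ∃ y₂ ∈ (rightSide (A * n) n : Set (Site 2)), ω ∈ openConnIn (rectangle (A * n) n : Set (Site 2)) x₁ y₁ ∧ ω ∈ openConnIn (rectangle (A * n) n : Set (Site 2)) x₂ y₂ ∧ ω ∉ openConnIn (rectangle (A * n) n : Set (Site 2)) x₁ x₂} := by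
  obtain ⟨γ₁, γ₂, -, h₂, -, h₄⟩ := h
  exact co_cardyOrderTwoLower_of_kacTwo γ₂ h₂ h₄

end Summit.CriticalPhenomena.CardyFormulaZ2.Cruxes.StripClusterRates.TwoClusterRateIsStationaryGap

end
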